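import Literature.Probability.RandomPlanarGeometry.HexSAWRotSurfaceYc
import Literature.Probability.RandomPlanarGeometry.HexSAWHammersleyWelshExplicit
import Literature.Probability.RandomPlanarGeometry.HexSAWRotStripDictionary
import Literature.Probability.RandomPlanarGeometry.HexSAWBrickWallBridgeDivergence
import HarnessLib

/-!
# Beaton's rotated-frame critical surface fugacity in GROWTH-RATE form: `limsup_n C⁺_n(y)^{1/n} ≤ μ ↔ y ≤ y†`
# (door (c-rot-growth) «HEX-YC-ROT-GROWTH-FORM» of the lane «pcv-sawmu», tree edition file R4 — continues R1–R3; frame twin of `HexSAWSurfaceYcGrowth.lean`)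

Topic `Literature/Probability/RandomPlanarGeometry` (continues `HexSAWRotSurfaceYc.lean` — R3: `hexRotSurfaceYc_eq : hexRotSurfaceYc =
rotYdagger`, Beaton 2014 Theorem 1 in RADIUS form, with its two half-plane faces `rotHPBelow_holds` / `rotHPAbove_holds` — and
`HexSAWRotSurfaceYcFaces.lean` — R1: the vocabulary `surfCount`, `rotHpV`, `rotHpLists`, `rotHpGF`, `RotHalfPlaneBounded`, `rotYcSet`).

Sources. N. R. Beaton, *The critical surface fugacity of self-avoiding walks on a rotated honeycomb lattice*, J. Phys. A 47
(2014) 075003 (arXiv:1210.0274), §3.1 (arXiv v3 p. 11: "`c^+_n(m)` is the number of `n`-step SAWs starting on the boundary of the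
half-space and occupying `m` vertices in the surface"; Proposition 7, p. 11: "`μ(y) := lim C_n^+(y)^{1/n}` exists … For `0 < y ≤ 1`,
`μ(y) = μ(1) = μ` … `μ(y) = μ` if `y ≤ y_c`, `> μ` if `y > y_c`"; Theorem 1 p. 2).  J. M. Hammersley, G. M. Torrie, S. G. Whittington,
J. Phys. A 15 (1982) 539 (existence of the limit, invoked by Beaton; NOT formalised).

## What is proved (lane «pub-sawmu», door (c-rot-growth))

DESIGN AND AUTHORSHIP.  Statements and proofs are a-idea-1 gen 19's HOME sketch `Sketch_G19_RotYcGrowth.lean` ed.2 (sha16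
9507a3cb31d02a67, 2026-08-23; decl map `DECLMAP_RG.md`) VERBATIM — only this module docstring is retitled — filed by the
rotated-door filer lineage a-p6 (gen 9) after R3 `HexSAWRotSurfaceYc.lean` landed.


R3 decides Beaton's `y_c` as a sup-RADIUS (`rotYcSet`).  This file is the verbatim frame twin of T4 `HexSAWSurfaceYcGrowth.lean`
(DCS frame) for Beaton's rotated surface, junk-free (explicit rates `r`, no `Filter.limsup`):
* `rotHpWalks n` = the self-avoiding vertex lists from `a⁺ = hvOrigin` with `n` vertices inside the rotated half-plane `{ξ ≤ 0}`;
  `rotHpCoeff n y = C⁺_n(y) := Σ_{γ ∈ rotHpWalks n} y^{surfCount γ}` (R1's weight: `x^{#vertices} y^{#vertices on ξ = 0}`);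
* BOX EXHAUSTION `isChain_xi_xX_bound` / `rotHpWalks_subset_rotHpLists`: an `n`-vertex walk from `a⁺` lies in R1's box `rotHpV n n`;
* `rotHalfPlaneBounded_iff_summable : RotHalfPlaneBounded x y ↔ Summable (C⁺_n(y) xⁿ)` (`x, y ≥ 0`);
* rate forms `RotGrowthLe y` (`∀ r > μ`, eventually `C⁺_n(y) ≤ rⁿ`), `RotGrowthGt y` (`∃ r > μ`, frequently `C⁺_n(y) ≥ rⁿ`);
* from R3's faces: `rotGrowthLe_holds : 0 < y → y < y† → RotGrowthLe y`, `rotGrowthGt_holds : y† < y → RotGrowthGt y`;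
* the endpoint by rescaling (`surfCount γ ≤ #γ` ⇒ `C⁺_n(y') ≤ (y'/y)ⁿ C⁺_n(y)`): `rotGrowthLe_criticalPoint : RotGrowthLe rotYdagger`;
* headline **`rotGrowthLe_iff_le (hy0 : 0 < y) : RotGrowthLe y ↔ y ≤ rotYdagger`**, **`rotGrowthGt_iff (hy0 : 0 < y) : RotGrowthGt y ↔ rotYdagger < y`**,
  and **`rotGrowthLe_iff_le_hexRotSurfaceYc (hy0 : 0 < y) : RotGrowthLe y ↔ y ≤ hexRotSurfaceYc`** (R3's sup-radius IS the growth threshold).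
* the `≥ μ` half for EVERY `y > 0`: `not_rotHalfPlaneBounded_xc_one : ¬ RotHalfPlaneBounded x_c 1` (bridges on `ℍ` — tree
  `HexBW.half_log_le_sum_bridgeCount` (Madras–Slade (3.1.14)) through `HexBW.rot_dictionary` and R1's reversal `revTop` summed over depths),
  the lift `rotLift` (`y · C⁺_n(1) ≤ C⁺_{n+2}(y)`), **`rotGrowthGe_of_pos (hy : 0 < y) : RotGrowthGe y`** (`∀ 0 ≤ r < μ`, frequently `rⁿ ≤ C⁺_n(y)`),
  `rotGrowth_eq_holds_of_le : 0 < y → y ≤ y† → RotGrowthLe y ∧ RotGrowthGe y`.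
Not decided here: only the existence of the limit `lim C⁺_n(y)^{1/n}` (HTW82).
READING AS PRINTED (lit-1 g13, 2026-08-23): Beaton 2014 defines `y_c` through `μ(y)` (Proposition 7, growth form); the lane's rotated door R3
is in radius form; this file is the bookkeeping between the two in limsup language, including the endpoint `y = y_c` on the printed
side («`μ(y) = μ` if `y ≤ y_c`»); the existence of `lim C_n^+(y)^{1/n}` (Beaton's [9] = Hammersley–Torrie–Whittington 1982, "unfolded
walks") is not formalised.

LABEL: CONSOLIDATION (growth-rate form of R3; Beaton 2014 Prop. 7 / Thm 1; the `≥ μ` half = Whittington 1975 / Madras–Slade (3.1.14) in Beaton's frame) — box exhaustion / root test / rescaling / lift are folklore.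
-/

noncomputable section

open Finset Filter Topology

namespace Literature.Probability.RandomPlanarGeometry.SAW.HV

/-! ### The coefficient sequence `C⁺_n(y)` of the rotated half-plane -/

/-- **Rotated half-plane walks with `n` vertices**: self-avoiding vertex lists `γ = [a⁺ = O, γ₁, …]` of length `n` with every vertex in
`{ξ ≤ 0}`. [cite: Beaton2014RotatedHoneycomb, §3.1 (arXiv v3 p. 11: "`c^+_n(m)` is the number of `n`-step SAWs starting on the boundary of the half-space and occupying `m` vertices in the surface")] -/
def rotHpWalks (n : ℕ) : Finset (List HV) :=
  ((range n).biUnion fun m => sawFin hvOrigin m).filter fun l => l.length = n ∧ ∀ v ∈ l, 0 ≤ -xi v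

/-- Membership in `rotHpWalks`. [cite: Beaton2014RotatedHoneycomb, §3.1 (arXiv v3 p. 11: c^+_n(m))] -/
theorem mem_rotHpWalks_iff {n : ℕ} {l : List HV} :
    l ∈ rotHpWalks n ↔ l.IsChain hvGraph.Adj ∧ l.head? = some hvOrigin ∧ l.Nodup ∧ l.length = n ∧ ∀ v ∈ l, 0 ≤ -xi v := by
  rw [rotHpWalks, mem_filter, mem_biUnion]
  constructor
  · rintro ⟨⟨m, -, hm⟩, hlen, hV⟩
    obtain ⟨hc, hh, -, hnd⟩ := mem_sawLists_iff.1 (mem_sawFin_iff.1 hm)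
    exact ⟨hc, hh, hnd, hlen, hV⟩
  · rintro ⟨hc, hh, hnd, hlen, hV⟩
    have hl : l ≠ [] := by rintro rfl; simp at hh
    have hpos : 0 < l.length := List.length_pos_iff.2 hl
    refine ⟨⟨n - 1, mem_range.2 (by omega), mem_sawFin_iff.2 (mem_sawLists_iff.2 ⟨hc, hh, by omega, hnd⟩)⟩, hlen, hV⟩

/-- **`C⁺_n(y) := Σ_{γ : n vertices, rotated half-plane} y^{#surface vertices of γ}`** — Beaton's half-plane partition function in the
lane's vertex-list model (R1's weight `x^{#γ} y^{surfCount γ}` at fixed `#γ = n`).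
[cite: Beaton2014RotatedHoneycomb, §3.1 (arXiv v3 p. 11: C_n^+(y) = Σ_m c^+_n(m) y^m)] -/
def rotHpCoeff (n : ℕ) (y : ℝ) : ℝ := ∑ l ∈ rotHpWalks n, y ^ surfCount l

/-- `C⁺_n(y) ≥ 0` for `y ≥ 0`. [cite: Beaton2014RotatedHoneycomb, §3.1 (arXiv v3 p. 11: C_n^+(y))] -/
theorem rotHpCoeff_nonneg (n : ℕ) {y : ℝ} (hy : 0 ≤ y) : 0 ≤ rotHpCoeff n y :=
  sum_nonneg fun _ _ => pow_nonneg hy _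

/-- `C⁺_n` is non-decreasing in `y ≥ 0`. [cite: Beaton2014RotatedHoneycomb, Proposition 7 (arXiv v3 p. 11: "non-decreasing")] -/
theorem rotHpCoeff_mono (n : ℕ) {y y' : ℝ} (hy : 0 ≤ y) (hyy' : y ≤ y') : rotHpCoeff n y ≤ rotHpCoeff n y' :=
  sum_le_sum fun _ _ => pow_le_pow_left₀ hy hyy' _

/-! ### Box exhaustion: an `n`-vertex walk from `a⁺` stays in R1's box `rotHpV n n` -/

/-- Along a lattice chain `u, v₁, …, v_m`, Beaton's height `ξ` moves by at most `m` and the abscissa `X` by at most `2m`.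
[cite: Beaton2014RotatedHoneycomb, §2 (Fig. 1(b): the rotated frame), §2.2 (D_{T,L}; arXiv v3 p. 5)] -/
theorem isChain_xi_xX_bound : ∀ (u : HV) (M : List HV), (u :: M).IsChain hvGraph.Adj →
    ∀ v ∈ u :: M, |xi v - xi u| ≤ M.length ∧ |xX v - xX u| ≤ 2 * M.length := by
  intro u M
  induction M generalizing u with
  | nil =>
    intro _ v hv
    rw [List.mem_singleton] at hv
    subst hv
    simp
  | cons u' M ih =>
    intro hc v hv
    rw [List.isChain_cons_cons] at hc
    obtain ⟨hadj, hc'⟩ := hc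
    have h1 := xi_adj hadj
    have h2 := abs_xX_sub_le_of_adj hadj
    rw [abs_le] at h2
    simp only [List.length_cons, Nat.cast_add, Nat.cast_one]
    rcases List.mem_cons.1 hv with rfl | hv'
    · constructor <;> rw [abs_le] <;> constructor <;> omega
    · obtain ⟨h3, h4⟩ := ih u' hc' v hv'
      rw [abs_le] at h3 h4 ⊢
      constructor
      · constructor <;> omega
      · rw [abs_le]; constructor <;> omega

/-- R1's boxes grow with `T` and `L`. [cite: Beaton2014RotatedHoneycomb, §2.2 (D_{T,L}; arXiv v3 p. 5)] -/
theorem rotHpLists_mono {T T' L L' : ℕ} (hT : T ≤ T') (hL : L ≤ L') : rotHpLists T L ⊆ rotHpLists T' L' := by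
  intro l hl
  rw [mem_rotHpLists_iff] at hl ⊢
  obtain ⟨hc, hh, hnd, hV⟩ := hl
  refine ⟨hc, hh, hnd, fun v hv => ?_⟩
  have := mem_rotHpV_iff.1 (hV v hv)
  rw [mem_rotHpV_iff]
  refine ⟨this.1, this.2.1.trans (by exact_mod_cast hT), this.2.2.trans_le (by nlinarith)⟩

/-- **Box exhaustion**: an `n`-vertex rotated half-plane walk from `a⁺` lies in the box `rotHpV N N` for every `N ≥ n`.
[cite: Beaton2014RotatedHoneycomb, §3.1 (arXiv v3 p. 11: c^+_n(m)), §2.2 (D_{T,L})] -/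
theorem rotHpWalks_subset_rotHpLists {n N : ℕ} (hnN : n ≤ N) : rotHpWalks n ⊆ rotHpLists N N := by
  intro l hl
  obtain ⟨hc, hh, hnd, hlen, hV⟩ := mem_rotHpWalks_iff.1 hl
  rw [mem_rotHpLists_iff]
  refine ⟨hc, hh, hnd, fun v hv => ?_⟩
  obtain ⟨M, rfl⟩ : ∃ M, l = hvOrigin :: M := by
    cases l with
    | nil => simp at hh
    | cons a M => simp at hh; exact ⟨M, by rw [hh]⟩
  have hb := isChain_xi_xX_bound hvOrigin M hc v hv
  rw [xi_hvOrigin, xX_hvOrigin, abs_le, abs_le] at hb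
  simp only [List.length_cons] at hlen
  rw [mem_rotHpV_iff, abs_lt]
  refine ⟨hV v hv, ?_, ?_⟩ <;> omega

/-- The length-`n` fibre of ANY box sits inside `rotHpWalks n`. [cite: Beaton2014RotatedHoneycomb, §3.1 (arXiv v3 p. 11: c^+_n(m))] -/
theorem rotHpFibre_subset (T L n : ℕ) : (rotHpLists T L).filter (fun l => l.length = n) ⊆ rotHpWalks n := by
  intro l hl
  rw [mem_filter] at hl
  obtain ⟨hc, hh, hnd, hV⟩ := mem_rotHpLists_iff.1 hl.1
  exact mem_rotHpWalks_iff.2 ⟨hc, hh, hnd, hl.2, fun v hv => (mem_rotHpV_iff.1 (hV v hv)).1⟩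

/-! ### `RotHalfPlaneBounded x y ↔ Σ_n C⁺_n(y) xⁿ < ∞` -/

/-- Partial sums are dominated by a box: `Σ_{n ≤ N} C⁺_n(y) xⁿ ≤ C⁺_{N,N}(x, y)`.
[cite: Beaton2014RotatedHoneycomb, §3.1 (arXiv v3 p. 11: C_n^+(y)), Proposition 7 (p. 11)] -/
theorem sum_range_rotHpCoeff_le (N : ℕ) {x y : ℝ} (hx : 0 ≤ x) (hy : 0 ≤ y) :
    ∑ n ∈ range (N + 1), rotHpCoeff n y * x ^ n ≤ rotHpGF N N x y := by
  have hdisj : ∀ n ∈ range (N + 1), ∀ m ∈ range (N + 1), n ≠ m → Disjoint (rotHpWalks n) (rotHpWalks m) := by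
    intro n _ m _ hnm
    rw [Finset.disjoint_left]
    intro l hln hlm
    exact hnm ((mem_rotHpWalks_iff.1 hln).2.2.2.1.symm.trans (mem_rotHpWalks_iff.1 hlm).2.2.2.1)
  calc ∑ n ∈ range (N + 1), rotHpCoeff n y * x ^ n
      = ∑ n ∈ range (N + 1), ∑ l ∈ rotHpWalks n, x ^ l.length * y ^ surfCount l := by
        refine sum_congr rfl fun n _ => ?_
        rw [rotHpCoeff, sum_mul]
        refine sum_congr rfl fun l hl => ?_
        rw [(mem_rotHpWalks_iff.1 hl).2.2.2.1]; ring
    _ = ∑ l ∈ (range (N + 1)).biUnion rotHpWalks, x ^ l.length * y ^ surfCount l := (sum_biUnion hdisj).symm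
    _ ≤ rotHpGF N N x y := by
        refine sum_le_sum_of_subset_of_nonneg ?_ fun _ _ _ => mul_nonneg (pow_nonneg hx _) (pow_nonneg hy _)
        intro l hl
        rw [mem_biUnion] at hl
        obtain ⟨n, hn, hl⟩ := hl
        exact rotHpWalks_subset_rotHpLists (by rw [mem_range] at hn; omega) hl

/-- Every box is dominated by the full series: `C⁺_{T,L}(x, y) ≤ Σ_n C⁺_n(y) xⁿ` (when it converges).
[cite: Beaton2014RotatedHoneycomb, §3.1 (arXiv v3 p. 11: C_n^+(y)), Proposition 7 (p. 11)] -/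
theorem rotHpGF_le_tsum (T L : ℕ) {x y : ℝ} (hx : 0 ≤ x) (hy : 0 ≤ y) (hs : Summable fun n => rotHpCoeff n y * x ^ n) :
    rotHpGF T L x y ≤ ∑' n, rotHpCoeff n y * x ^ n := by
  set MW := rotHpLists T L with hMW
  set B := MW.sup List.length + 1 with hB
  have hmaps : ∀ l ∈ MW, l.length ∈ range B := fun l hl => mem_range.2 (Nat.lt_succ_of_le (le_sup (f := List.length) hl))
  have h1 : rotHpGF T L x y = ∑ n ∈ range B, ∑ l ∈ MW.filter (fun l => l.length = n), x ^ l.length * y ^ surfCount l := by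
    rw [rotHpGF, sum_fiberwise_of_maps_to hmaps]
  have h2 : ∀ n, ∑ l ∈ MW.filter (fun l => l.length = n), x ^ l.length * y ^ surfCount l ≤ rotHpCoeff n y * x ^ n := by
    intro n
    calc ∑ l ∈ MW.filter (fun l => l.length = n), x ^ l.length * y ^ surfCount l
        = ∑ l ∈ MW.filter (fun l => l.length = n), y ^ surfCount l * x ^ n := by
          refine sum_congr rfl fun l hl => ?_
          rw [(mem_filter.1 hl).2]; ring
      _ ≤ ∑ l ∈ rotHpWalks n, y ^ surfCount l * x ^ n :=
          sum_le_sum_of_subset_of_nonneg (rotHpFibre_subset T L n) fun _ _ _ => mul_nonneg (pow_nonneg hy _) (pow_nonneg hx _)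
      _ = rotHpCoeff n y * x ^ n := by rw [rotHpCoeff, sum_mul]
  rw [h1]
  calc ∑ n ∈ range B, ∑ l ∈ MW.filter (fun l => l.length = n), x ^ l.length * y ^ surfCount l
      ≤ ∑ n ∈ range B, rotHpCoeff n y * x ^ n := sum_le_sum fun n _ => h2 n
    _ ≤ ∑' n, rotHpCoeff n y * x ^ n := hs.sum_le_tsum _ fun n _ => mul_nonneg (rotHpCoeff_nonneg n hy) (pow_nonneg hx _)

/-- **Box exhaustion ⇔ summability** in the rotated frame: `C⁺(x, y) < ∞` (bounded boxes) iff `Σ_n C⁺_n(y) xⁿ` converges (`x, y ≥ 0`).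
[cite: Beaton2014RotatedHoneycomb, Proposition 7 (arXiv v3 p. 11: μ(y) = μ iff y ≤ y_c), §3.1 (C_n^+(y))] -/
theorem rotHalfPlaneBounded_iff_summable {x y : ℝ} (hx : 0 ≤ x) (hy : 0 ≤ y) :
    RotHalfPlaneBounded x y ↔ Summable fun n => rotHpCoeff n y * x ^ n := by
  constructor
  · rintro ⟨K, hK⟩
    refine summable_of_sum_range_le (c := K) (fun n => mul_nonneg (rotHpCoeff_nonneg n hy) (pow_nonneg hx n)) fun N => ?_
    calc ∑ n ∈ range N, rotHpCoeff n y * x ^ n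
        ≤ ∑ n ∈ range (N + 1), rotHpCoeff n y * x ^ n :=
          sum_le_sum_of_subset_of_nonneg (range_mono (Nat.le_succ N))
            fun n _ _ => mul_nonneg (rotHpCoeff_nonneg n hy) (pow_nonneg hx n)
      _ ≤ rotHpGF N N x y := sum_range_rotHpCoeff_le N hx hy
      _ ≤ K := hK ⟨(N, N), rfl⟩
  · intro hs
    exact ⟨∑' n, rotHpCoeff n y * x ^ n, by rintro _ ⟨⟨T, L⟩, rfl⟩; exact rotHpGF_le_tsum T L hx hy hs⟩

/-! ### The rate forms and their faces -/

/-- **`limsup_n C⁺_n(y)^{1/n} ≤ μ`**, rate form: every `r > μ` eventually dominates. [cite: Beaton2014RotatedHoneycomb, Proposition 7 (arXiv v3 p. 11: "μ(y) = μ if y ≤ y_c")] -/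
def RotGrowthLe (y : ℝ) : Prop := ∀ r : ℝ, hexConnectiveConstant < r → ∀ᶠ n : ℕ in atTop, rotHpCoeff n y ≤ r ^ n

/-- **`limsup_n C⁺_n(y)^{1/n} > μ`**, rate form: some `r > μ` is reached infinitely often. [cite: Beaton2014RotatedHoneycomb, Proposition 7 (arXiv v3 p. 11: "μ(y) > μ if y > y_c")] -/
def RotGrowthGt (y : ℝ) : Prop := ∃ r : ℝ, hexConnectiveConstant < r ∧ ∃ᶠ n : ℕ in atTop, r ^ n ≤ rotHpCoeff n y

/-- **`y ∈ rotYcSet` ⇒ `limsup C⁺_n(y)^{1/n} ≤ μ`** (root test at `x = r⁻¹ < x_c`). [cite: Beaton2014RotatedHoneycomb, Proposition 7 (arXiv v3 p. 11)] -/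
theorem rotGrowthLe_of_mem_rotYcSet {y : ℝ} (hy : y ∈ rotYcSet) : RotGrowthLe y := by
  intro r hr
  have hxc := hexCriticalFugacity_pos_lt_one.1
  have hr0 : 0 < r := lt_trans (by rw [hexConnectiveConstant_eq_inv]; positivity) hr
  have hx0 : 0 < r⁻¹ := inv_pos.2 hr0
  have hxlt : r⁻¹ < hexCriticalFugacity := by
    rw [hexConnectiveConstant_eq_inv] at hr
    calc r⁻¹ < hexCriticalFugacity⁻¹⁻¹ := inv_strictAnti₀ (inv_pos.2 hxc) hr
      _ = hexCriticalFugacity := inv_inv _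
  have hs := (rotHalfPlaneBounded_iff_summable hx0.le hy.1).1 (hy.2 r⁻¹ hx0 hxlt)
  have ht := hs.tendsto_atTop_zero
  filter_upwards [ht.eventually (gt_mem_nhds zero_lt_one)] with n hn
  rw [inv_pow, mul_inv_lt_iff₀ (pow_pos hr0 n), one_mul] at hn
  exact hn.le

/-- **`C⁺(x, y)` unbounded at some `x < x_c` ⇒ `limsup C⁺_n(y)^{1/n} > μ`** (`y ≥ 0`). [cite: Beaton2014RotatedHoneycomb, Proposition 7 (arXiv v3 p. 11)] -/
theorem rotGrowthGt_of_not_rotHalfPlaneBounded {x y : ℝ} (hy : 0 ≤ y) (hx : 0 < x) (hxc : x < hexCriticalFugacity)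
    (hnb : ¬ RotHalfPlaneBounded x y) : RotGrowthGt y := by
  have hinv : hexCriticalFugacity⁻¹ < x⁻¹ := inv_strictAnti₀ hx hxc
  refine ⟨(x⁻¹ + hexCriticalFugacity⁻¹) / 2, by rw [hexConnectiveConstant_eq_inv]; linarith, ?_⟩
  set r : ℝ := (x⁻¹ + hexCriticalFugacity⁻¹) / 2 with hr
  have hq1 : r * x < 1 := by
    have : r < x⁻¹ := by rw [hr]; linarith
    calc r * x < x⁻¹ * x := mul_lt_mul_of_pos_right this hx
      _ = 1 := inv_mul_cancel₀ hx.ne'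
  have hq0 : 0 ≤ r * x := by
    have hxc0 := hexCriticalFugacity_pos_lt_one.1
    rw [hr]; positivity
  by_contra hcon
  rw [Filter.not_frequently] at hcon
  apply hnb
  rw [rotHalfPlaneBounded_iff_summable hx.le hy]
  refine Summable.of_norm_bounded_eventually_nat (g := fun n => (r * x) ^ n) (summable_geometric_of_lt_one hq0 hq1) ?_
  filter_upwards [hcon] with n hn
  rw [not_le] at hn
  rw [Real.norm_of_nonneg (mul_nonneg (rotHpCoeff_nonneg n hy) (pow_nonneg hx.le n)), mul_pow]
  exact mul_le_mul_of_nonneg_right hn.le (pow_nonneg hx.le n)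

/-- The two rate forms exclude each other. [cite: Beaton2014RotatedHoneycomb, Proposition 7 (arXiv v3 p. 11)] -/
theorem not_rotGrowthLe_of_rotGrowthGt {y : ℝ} (h : RotGrowthGt y) : ¬ RotGrowthLe y := by
  obtain ⟨r, hr, hfr⟩ := h
  intro hle
  have hμ0 : 0 < hexConnectiveConstant := by rw [hexConnectiveConstant_eq_inv]; exact inv_pos.2 hexCriticalFugacity_pos_lt_one.1
  set r' : ℝ := (hexConnectiveConstant + r) / 2 with hr'
  have h1 : hexConnectiveConstant < r' := by rw [hr']; linarith
  have h2 : r' < r := by rw [hr']; linarith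
  have h0 : 0 ≤ r' := by rw [hr']; linarith
  have hev := (hle r' h1).and (eventually_ge_atTop 1)
  obtain ⟨n, hn, hle', hn1⟩ := (hfr.and_eventually hev).exists
  have : r' ^ n < r ^ n := pow_lt_pow_left₀ h2 h0 (by omega)
  linarith

/-- Below face ⇒ rate `≤ μ` on `(0, y†)`. [cite: Beaton2014RotatedHoneycomb, Theorem 1 (arXiv v3 p. 2), Proposition 7 (p. 11)] -/
theorem rotGrowthLe_of_lt (hBel : RotHPBelow) {y : ℝ} (hy0 : 0 < y) (hy : y < rotYdagger) : RotGrowthLe y :=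
  rotGrowthLe_of_mem_rotYcSet (mem_rotYcSet_of_lt hBel hy0 hy)

/-- Above face ⇒ rate `> μ` on `(y†, ∞)`. [cite: Beaton2014RotatedHoneycomb, Theorem 1 (arXiv v3 p. 2), Proposition 7 (p. 11)] -/
theorem rotGrowthGt_of_gt (hAb : RotHPAbove) {y : ℝ} (hy : rotYdagger < y) : RotGrowthGt y := by
  obtain ⟨x, hx0, hxc, hnb⟩ := hAb y hy
  exact rotGrowthGt_of_not_rotHalfPlaneBounded (le_of_lt (lt_trans (lt_trans zero_lt_one one_lt_rotYdagger) hy)) hx0 hxc hnb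

/-! ### The critical point itself, by the rescaling bound `C⁺_n(y') ≤ (y'/y)ⁿ C⁺_n(y)` -/

/-- `surfCount γ ≤ #γ`: surface vertices are vertices. [cite: Beaton2014RotatedHoneycomb, §3.1 (arXiv v3 p. 11: "occupying m vertices in the surface")] -/
theorem surfCount_le_length (l : List HV) : surfCount l ≤ l.length := List.length_filter_le _ _

/-- **Rescaling: `C⁺_n(y') ≤ (y'/y)ⁿ · C⁺_n(y)` for `0 < y ≤ y'`.** [cite: Beaton2014RotatedHoneycomb, §3.1 (arXiv v3 p. 11: C_n^+(y) = Σ_m c^+_n(m) y^m)] -/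
theorem rotHpCoeff_le_pow_mul {y y' : ℝ} (hy : 0 < y) (hyy' : y ≤ y') (n : ℕ) : rotHpCoeff n y' ≤ (y' / y) ^ n * rotHpCoeff n y := by
  rw [rotHpCoeff, rotHpCoeff, mul_sum]
  refine sum_le_sum fun l hl => ?_
  have hc : surfCount l ≤ n := (mem_rotHpWalks_iff.1 hl).2.2.2.1 ▸ surfCount_le_length l
  have h1 : 1 ≤ y' / y := (one_le_div hy).2 hyy'
  calc y' ^ surfCount l = (y' / y) ^ surfCount l * y ^ surfCount l := by rw [← mul_pow, div_mul_cancel₀ _ hy.ne']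
    _ ≤ (y' / y) ^ n * y ^ surfCount l := mul_le_mul_of_nonneg_right (pow_le_pow_right₀ h1 hc) (pow_nonneg hy.le _)

/-- **`RotGrowthLe` passes to right endpoints.** [cite: Beaton2014RotatedHoneycomb, Proposition 7 (arXiv v3 p. 11: "μ(y) = μ if y ≤ y_c" — the endpoint included)] -/
theorem rotGrowthLe_of_forall_lt {y : ℝ} (hy : 0 < y) (h : ∀ y' : ℝ, 0 < y' → y' < y → RotGrowthLe y') : RotGrowthLe y := by
  intro r hr
  have hμ0 : 0 < hexConnectiveConstant := by
    rw [hexConnectiveConstant_eq_inv]; exact inv_pos.2 hexCriticalFugacity_pos_lt_one.1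
  have hr0 : 0 < r := hμ0.trans hr
  set q : ℝ := (hexConnectiveConstant + r) / (2 * r) with hq
  have hq0 : 0 < q := by positivity
  have hq1 : q < 1 := by rw [hq, div_lt_one (by positivity)]; linarith
  have hy'0 : 0 < y * q := mul_pos hy hq0
  have hy'y : y * q < y := mul_lt_of_lt_one_right hy hq1
  have hrate : hexConnectiveConstant < (hexConnectiveConstant + r) / 2 := by linarith
  filter_upwards [h (y * q) hy'0 hy'y _ hrate] with n hn
  calc rotHpCoeff n y ≤ (y / (y * q)) ^ n * rotHpCoeff n (y * q) := rotHpCoeff_le_pow_mul hy'0 hy'y.le n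
    _ ≤ (y / (y * q)) ^ n * ((hexConnectiveConstant + r) / 2) ^ n :=
        mul_le_mul_of_nonneg_left hn (pow_nonneg (div_nonneg hy.le hy'0.le) n)
    _ = r ^ n := by
        rw [← mul_pow]
        congr 1
        rw [hq]
        field_simp

/-- Parametric form of the FULL dichotomy (inputs R3's two faces): `limsup C⁺_n(y)^{1/n} ≤ μ ↔ y ≤ y†` for `y > 0`.
[cite: Beaton2014RotatedHoneycomb, Theorem 1 (arXiv v3 p. 2) with Proposition 7 (p. 11: "μ(y) = μ if y ≤ y_c, > μ if y > y_c")] -/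
theorem rotGrowthLe_iff_le_of_faces (hBel : RotHPBelow) (hAb : RotHPAbove) {y : ℝ} (hy0 : 0 < y) :
    RotGrowthLe y ↔ y ≤ rotYdagger := by
  constructor
  · intro h
    by_contra hgt
    rw [not_le] at hgt
    exact not_rotGrowthLe_of_rotGrowthGt (rotGrowthGt_of_gt hAb hgt) h
  · intro hle
    rcases hle.lt_or_eq with hlt | rfl
    · exact rotGrowthLe_of_lt hBel hy0 hlt
    · exact rotGrowthLe_of_forall_lt hy0 fun _ h0 h => rotGrowthLe_of_lt hBel h0 h

/-! ### Unconditional forms (R3: `rotHPBelow_holds`, `rotHPAbove_holds`, `hexRotSurfaceYc_eq`) -/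

/-- `0 < y < y†` ⇒ `limsup C⁺_n(y)^{1/n} ≤ μ`. [cite: Beaton2014RotatedHoneycomb, Theorem 1 (arXiv v3 p. 2), Proposition 7 (p. 11)] -/
theorem rotGrowthLe_holds {y : ℝ} (hy0 : 0 < y) (hy : y < rotYdagger) : RotGrowthLe y := rotGrowthLe_of_lt rotHPBelow_holds hy0 hy

/-- `y† < y` ⇒ `limsup C⁺_n(y)^{1/n} > μ`. [cite: Beaton2014RotatedHoneycomb, Theorem 1 (arXiv v3 p. 2), Proposition 7 (p. 11)] -/
theorem rotGrowthGt_holds {y : ℝ} (hy : rotYdagger < y) : RotGrowthGt y := rotGrowthGt_of_gt rotHPAbove_holds hy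

/-- **AT the critical point the rate is still `≤ μ`.** [cite: Beaton2014RotatedHoneycomb, Proposition 7 (arXiv v3 p. 11: "μ(y) = μ if y ≤ y_c" — the endpoint included)] -/
theorem rotGrowthLe_criticalPoint : RotGrowthLe rotYdagger :=
  rotGrowthLe_of_forall_lt rotYdagger_pos fun _ hy0 hy => rotGrowthLe_holds hy0 hy

/-- **Beaton 2014 Theorem 1 / Proposition 7 — the FULL dichotomy in growth-rate form:** for every `y > 0`,
`limsup_n C⁺_n(y)^{1/n} ≤ μ ↔ y ≤ y†`. [cite: Beaton2014RotatedHoneycomb, Theorem 1 (arXiv v3 p. 2) with Proposition 7 (p. 11: "μ(y) = μ if y ≤ y_c, > μ if y > y_c")] -/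
theorem rotGrowthLe_iff_le {y : ℝ} (hy0 : 0 < y) : RotGrowthLe y ↔ y ≤ rotYdagger :=
  rotGrowthLe_iff_le_of_faces rotHPBelow_holds rotHPAbove_holds hy0

/-- **… and `limsup_n C⁺_n(y)^{1/n} > μ ↔ y† < y`** (`0 < y`). [cite: Beaton2014RotatedHoneycomb, Theorem 1 (arXiv v3 p. 2) with Proposition 7 (p. 11: "μ(y) > μ if y > y_c")] -/
theorem rotGrowthGt_iff {y : ℝ} (hy0 : 0 < y) : RotGrowthGt y ↔ rotYdagger < y := by
  constructor
  · intro h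
    by_contra hle
    rw [not_lt] at hle
    exact not_rotGrowthLe_of_rotGrowthGt h ((rotGrowthLe_iff_le hy0).2 hle)
  · exact rotGrowthGt_holds

/-- Off the critical point, the strict form (T4's `growthLe_iff` twin). [cite: Beaton2014RotatedHoneycomb, Theorem 1 (arXiv v3 p. 2), Proposition 7 (p. 11)] -/
theorem rotGrowthLe_iff {y : ℝ} (hy0 : 0 < y) (hne : y ≠ rotYdagger) : RotGrowthLe y ↔ y < rotYdagger := by
  rw [rotGrowthLe_iff_le hy0, le_iff_lt_or_eq, or_iff_left hne]

/-- **R3's sup-radius `y_c` IS the growth-rate threshold of the rotated surface:** `limsup C⁺_n(y)^{1/n} ≤ μ ↔ y ≤ hexRotSurfaceYc` (`y > 0`).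
[cite: Beaton2014RotatedHoneycomb, Proposition 7 (arXiv v3 p. 11: μ(y) = μ iff y ≤ y_c), Theorem 1 (p. 2); GlazmanManolescu2019, Definition 1.1 (arXiv v3 p. 5: the definition shape, DCS frame)] -/
theorem rotGrowthLe_iff_le_hexRotSurfaceYc {y : ℝ} (hy0 : 0 < y) : RotGrowthLe y ↔ y ≤ hexRotSurfaceYc := by
  rw [hexRotSurfaceYc_eq]
  exact rotGrowthLe_iff_le hy0

/-! ### The `≥ μ` half (Whittington 1975 in Beaton's frame): `limsup_n C⁺_n(y)^{1/n} ≥ μ` for every `y > 0`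

`y ≥ 1`: by monotonicity it suffices that `Σ_n C⁺_n(1) x_cⁿ = +∞`, i.e. `C⁺(x_c, 1)` has unbounded boxes.  Every brick-wall
bridge of span `A ≥ 1` and length `m ≤ M` is a TOP walk of Beaton's strip `D(A, M+1)` (tree `HexBW.rot_dictionary`), whose
reversal is a half-plane walk of the box `rotHpV M (6M + 12)` ending at height `ξ = −A` (R1's `revTop`); the boxes being
bounded would bound `Σ_{1 ≤ m ≤ M} b_m(ℍ) μ^{−m}` uniformly in `M`, against Madras–Slade (3.1.14) on `ℍ`
(tree `HexBW.half_log_le_sum_bridgeCount`: `≥ ½ log((M+1)/μ)`).  `y < 1`: the lift `γ ↦ a⁺, q₁, γ − (1,0,0)` (`q₁ = (−1,0,1)`,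
heights `0, −1`, then `ξ − 2`) is injective `rotHpWalks n → rotHpWalks (n+2)` with exactly one surface vertex, so
`C⁺_{n+2}(y) ≥ y · C⁺_n(1)`. -/

/-- **`limsup_n C⁺_n(y)^{1/n} ≥ μ`**, rate form: every `0 ≤ r < μ` is reached infinitely often.
[cite: Beaton2014RotatedHoneycomb, Proposition 7 (arXiv v3 p. 11: "for any y > 0, μ(y) ≥ max{μ, √y}")] -/
def RotGrowthGe (y : ℝ) : Prop := ∀ r : ℝ, 0 ≤ r → r < hexConnectiveConstant → ∃ᶠ n : ℕ in atTop, r ^ n ≤ rotHpCoeff n y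

/-- `B^{→}_{H,W}(x_c) = Σ_{top lists} x_c^{#vertices}` (R1's list model of the top walks at `y = 1`).
[cite: Beaton2014RotatedHoneycomb, §2.2 (B_{T,L}; arXiv v3 p. 5)] -/
theorem rotStripBR_eq_sum_rotTopLists {H Wd : ℕ} (hH : 1 ≤ H) :
    rotStripBR H Wd = ∑ l ∈ rotTopLists H Wd, hexCriticalFugacity ^ l.length := by
  rw [rotStripBR_eq_rotGF, ← rotGFy_one _ H, ← rotStripGFxy_xc, rotStripGFxy_top_eq hH]
  simp only [one_pow, mul_one]

/-- `C⁺_{T,L}(x, 1) = Σ_{box lists} x^{#vertices}`. [cite: Beaton2014RotatedHoneycomb, §3.1 (arXiv v3 p. 11: C^+_T(x, y) at y = 1)] -/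
theorem rotHpGF_one (T L : ℕ) (x : ℝ) : rotHpGF T L x 1 = ∑ l ∈ rotHpLists T L, x ^ l.length := by
  simp only [rotHpGF, one_pow, mul_one]

/-- The reversed top lists of depth `A` end at height `ξ = −A`. [cite: Beaton2014RotatedHoneycomb, §3.2 ("By the symmetry of bridges", arXiv v3 p. 15)] -/
theorem exists_getLast?_of_mem_image_revTop {A Wd : ℕ} (hA : 1 ≤ A) {g : List HV}
    (hg : g ∈ (rotTopLists A Wd).image (revTop A)) : ∃ v, g.getLast? = some v ∧ xi v = -(A : ℤ) := by
  obtain ⟨l, hl, rfl⟩ := mem_image.1 hg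
  exact ⟨_, getLast?_revTop hA hl, by rw [xi_nmap, xi_hvOrigin, sub_zero]⟩

/-- **Multi-depth reversal injection: `Σ_{A=1}^{M} B^{→}_{A,W}(x) ≤ C⁺_{M, 3M+3W+9}(x, 1)`** — the reversed top walks of
different depths `A` end at different heights, so R1's injections `revTop A` have pairwise disjoint images in one box.
[cite: Beaton2014RotatedHoneycomb, §3.2 ("By the symmetry of bridges", arXiv v3 p. 15)] -/
theorem sum_sum_rotTopLists_le_rotHpGF (M Wd : ℕ) {x : ℝ} (hx : 0 ≤ x) :
    ∑ A ∈ range M, ∑ l ∈ rotTopLists (A + 1) Wd, x ^ l.length ≤ rotHpGF M (3 * M + 3 * Wd + 9) x 1 := by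
  have hA1 : ∀ A : ℕ, 1 ≤ A + 1 := fun A => Nat.succ_pos A
  have h1 : ∀ A ∈ range M, ∑ l ∈ rotTopLists (A + 1) Wd, x ^ l.length
      = ∑ g ∈ (rotTopLists (A + 1) Wd).image (revTop (A + 1)), x ^ g.length := by
    intro A _
    rw [sum_image (revTop_injOn (hA1 A))]
    simp only [length_revTop]
  have hdisj : ∀ A ∈ range M, ∀ A' ∈ range M, A ≠ A' →
      Disjoint ((rotTopLists (A + 1) Wd).image (revTop (A + 1))) ((rotTopLists (A' + 1) Wd).image (revTop (A' + 1))) := by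
    intro A _ A' _ hne
    rw [Finset.disjoint_left]
    intro g hg hg'
    obtain ⟨v, hv, hxv⟩ := exists_getLast?_of_mem_image_revTop (hA1 A) hg
    obtain ⟨v', hv', hxv'⟩ := exists_getLast?_of_mem_image_revTop (hA1 A') hg'
    rw [hv] at hv'
    have hvv : v = v' := Option.some_injective _ hv'
    subst hvv
    push_cast at hxv hxv'
    omega
  have hsub : ((range M).biUnion fun A => (rotTopLists (A + 1) Wd).image (revTop (A + 1)))
      ⊆ rotHpLists M (3 * M + 3 * Wd + 9) := by
    intro g hg
    rw [mem_biUnion] at hg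
    obtain ⟨A, hA, hg⟩ := hg
    rw [mem_range] at hA
    obtain ⟨l, hl, rfl⟩ := mem_image.1 hg
    exact rotHpLists_mono (by omega) (by omega) (revTop_mem (hA1 A) hl)
  rw [sum_congr rfl h1, ← sum_biUnion hdisj, rotHpGF_one]
  exact sum_le_sum_of_subset_of_nonneg hsub fun _ _ _ => pow_nonneg hx _

/-- A brick-wall bridge of length `n ≥ 1` has span `A ∈ [1, n]`: `b_n(ℍ) ≤ Σ_{A=1}^{k} b_{n,A}(ℍ)` for `k ≥ n`.
[cite: MadrasSlade1993, Definition 1.2.4, §3.1 (proof of Corollary 3.1.8: the span decomposition)] -/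
theorem bridgeCount_le_sum_card_brSpan {n k : ℕ} (hn : 1 ≤ n) (hnk : n ≤ k) :
    (HexBW.bridgeCount n : ℝ) ≤ ∑ a ∈ range k, (#(HexBW.brSpan n (a + 1 : ℕ)) : ℝ) := by
  classical
  have hsub : HexBW.bridges n ⊆ (range k).biUnion fun a => HexBW.brSpan n (a + 1 : ℕ) := by
    intro ω hω
    obtain ⟨hωs, hωb⟩ := HexBW.mem_bridges.1 hω
    obtain ⟨h00, -, hadj, -⟩ := Zd.mem_saws.1 (HexBW.saws_subset n hωs)
    have h0 : ω 0 0 = 0 := by rw [h00]; rfl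
    have hlo : 0 < ω n 0 := by have h := (hωb n hn le_rfl).1; rwa [h0] at h
    have hhi : ω n 0 ≤ n := (le_abs_self _).trans (Zd.abs_apply_le_of_adj h00 hadj n le_rfl 0)
    rw [mem_biUnion]
    refine ⟨(ω n 0).toNat - 1, mem_range.2 (by omega), ?_⟩
    rw [HexBW.brSpan, mem_filter]
    exact ⟨hω, by omega⟩
  calc (HexBW.bridgeCount n : ℝ) = (#(HexBW.bridges n) : ℝ) := rfl
    _ ≤ #((range k).biUnion fun a => HexBW.brSpan n (a + 1 : ℕ)) := by exact_mod_cast card_le_card hsub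
    _ ≤ ∑ a ∈ range k, (#(HexBW.brSpan n (a + 1 : ℕ)) : ℝ) := by exact_mod_cast card_biUnion_le

/-- `B⁺_M(z) ≤ Σ_{A=1}^{M} V_M(A)` (in fact `=`): the span decomposition of the truncated bridge series (`z ≥ 0`).
[cite: MadrasSlade1993, §3.1, proof of Corollary 3.1.8] -/
theorem bridgeGFpos_le_sum_brGF (M : ℕ) {z : ℝ} (hz : 0 ≤ z) :
    HexBW.bridgeGFpos M z ≤ ∑ a ∈ range M, HexBW.brGF M z (a + 1 : ℕ) := by
  rw [HexBW.bridgeGFpos]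
  calc ∑ n ∈ range (M + 1), (if n = 0 then (0 : ℝ) else (HexBW.bridgeCount n : ℝ) * z ^ n)
      ≤ ∑ n ∈ range (M + 1), ∑ a ∈ range M, (#(HexBW.brSpan n (a + 1 : ℕ)) : ℝ) * z ^ n := by
        refine sum_le_sum fun n hn => ?_
        rw [mem_range] at hn
        split_ifs with h0
        · exact sum_nonneg fun a _ => mul_nonneg (Nat.cast_nonneg _) (pow_nonneg hz _)
        · rw [← sum_mul]
          exact mul_le_mul_of_nonneg_right (bridgeCount_le_sum_card_brSpan (by omega) (by omega)) (pow_nonneg hz _)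
    _ = ∑ a ∈ range M, HexBW.brGF M z (a + 1 : ℕ) := by
        rw [sum_comm]
        rfl

/-- **`C⁺(x_c, 1) = +∞` in the rotated frame: the boxes `C⁺_{T,L}(x_c, 1)` are unbounded** (bridges: Madras–Slade (3.1.14)
on `ℍ` through Beaton's dictionary and the reversal injection).
[cite: Beaton2014RotatedHoneycomb, Proposition 7 (arXiv v3 p. 11: "μ(y) ≥ max{μ, √y}"), §3.2 (p. 15); MadrasSlade1993, Corollary 3.1.8, eq. (3.1.14)] -/
theorem not_rotHalfPlaneBounded_xc_one : ¬ RotHalfPlaneBounded hexCriticalFugacity 1 := by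
  rintro ⟨K, hK⟩
  have hxc := hexCriticalFugacity_pos_lt_one.1
  have hμ : hexConnectiveConstant = hexCriticalFugacity⁻¹ := hexConnectiveConstant_eq_inv
  have hμ0 : 0 < hexConnectiveConstant := by rw [hμ]; exact inv_pos.2 hxc
  have hbd : ∀ M : ℕ, HexBW.bridgeGFpos M hexConnectiveConstant⁻¹ ≤ hexCriticalFugacity⁻¹ * K := by
    intro M
    have hz : (0 : ℝ) ≤ hexConnectiveConstant⁻¹ := inv_nonneg.2 hμ0.le
    calc HexBW.bridgeGFpos M hexConnectiveConstant⁻¹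
        ≤ ∑ a ∈ range M, HexBW.brGF M hexConnectiveConstant⁻¹ (a + 1 : ℕ) := bridgeGFpos_le_sum_brGF M hz
      _ ≤ ∑ a ∈ range M, hexCriticalFugacity⁻¹ * ∑ l ∈ rotTopLists (a + 1) (M + 1), hexCriticalFugacity ^ l.length := by
          refine sum_le_sum fun a _ => ?_
          have h := HexBW.rot_dictionary (a + 1) (M + 1) (by omega)
          rw [rotStripBR_eq_sum_rotTopLists (by omega)] at h
          refine le_trans (le_of_eq ?_) h
          rw [HexBW.brGF]
          refine sum_congr rfl fun n _ => ?_
          rw [inv_pow, div_eq_mul_inv]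
      _ = hexCriticalFugacity⁻¹ * ∑ a ∈ range M, ∑ l ∈ rotTopLists (a + 1) (M + 1), hexCriticalFugacity ^ l.length := by
          rw [mul_sum]
      _ ≤ hexCriticalFugacity⁻¹ * rotHpGF M (3 * M + 3 * (M + 1) + 9) hexCriticalFugacity 1 :=
          mul_le_mul_of_nonneg_left (sum_sum_rotTopLists_le_rotHpGF M (M + 1) hxc.le) (inv_nonneg.2 hxc.le)
      _ ≤ hexCriticalFugacity⁻¹ * K :=
          mul_le_mul_of_nonneg_left (hK ⟨(M, 3 * M + 3 * (M + 1) + 9), rfl⟩) (inv_nonneg.2 hxc.le)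
  obtain ⟨M, hM⟩ : ∃ M : ℕ, hexCriticalFugacity⁻¹ * K * 2 < Real.log ((M + 1 : ℝ) / hexConnectiveConstant) := by
    have ht : Tendsto (fun M : ℕ => Real.log ((M + 1 : ℝ) / hexConnectiveConstant)) atTop atTop :=
      Real.tendsto_log_atTop.comp
        ((tendsto_natCast_atTop_atTop.atTop_add tendsto_const_nhds).atTop_div_const hμ0)
    exact (ht.eventually_gt_atTop _).exists
  have h1 := HexBW.half_log_le_sum_bridgeCount M
  have h2 := hbd (M + 1)
  linarith

/-- `Σ_n C⁺_n(1) x_cⁿ = +∞`. [cite: Beaton2014RotatedHoneycomb, Proposition 7 (arXiv v3 p. 11: "μ(y) ≥ max{μ, √y}")] -/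
theorem rotHpCoeff_one_not_summable : ¬ Summable (fun n => rotHpCoeff n 1 * hexCriticalFugacity ^ n) := fun hs =>
  not_rotHalfPlaneBounded_xc_one ((rotHalfPlaneBounded_iff_summable hexCriticalFugacity_pos_lt_one.1.le zero_le_one).2 hs)

/-- **`limsup C⁺_n(1)^{1/n} ≥ μ`.** [cite: Beaton2014RotatedHoneycomb, Proposition 7 (arXiv v3 p. 11: "For 0 < y ≤ 1, μ(y) = μ(1) = μ")] -/
theorem rotGrowthGe_one : RotGrowthGe 1 := by
  intro r hr0 hrμ
  by_contra hcon
  rw [Filter.not_frequently] at hcon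
  apply rotHpCoeff_one_not_summable
  have hxc := hexCriticalFugacity_pos_lt_one.1
  have hq1 : r * hexCriticalFugacity < 1 := by
    rw [hexConnectiveConstant_eq_inv] at hrμ
    calc r * hexCriticalFugacity < hexCriticalFugacity⁻¹ * hexCriticalFugacity := mul_lt_mul_of_pos_right hrμ hxc
      _ = 1 := inv_mul_cancel₀ hxc.ne'
  refine Summable.of_norm_bounded_eventually_nat (g := fun n => (r * hexCriticalFugacity) ^ n)
    (summable_geometric_of_lt_one (mul_nonneg hr0 hxc.le) hq1) ?_
  filter_upwards [hcon] with n hn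
  rw [not_le] at hn
  rw [Real.norm_of_nonneg (mul_nonneg (rotHpCoeff_nonneg n zero_le_one) (pow_nonneg hxc.le n)), mul_pow]
  exact mul_le_mul_of_nonneg_right hn.le (pow_nonneg hxc.le n)

/-- `y ≥ 1` ⇒ `limsup C⁺_n(y)^{1/n} ≥ μ` (monotonicity). [cite: Beaton2014RotatedHoneycomb, Proposition 7 (arXiv v3 p. 11: "μ(y) ≥ max{μ, √y}")] -/
theorem rotGrowthGe_of_one_le {y : ℝ} (hy : 1 ≤ y) : RotGrowthGe y := fun r hr0 hrμ =>
  (rotGrowthGe_one r hr0 hrμ).mono fun n hn => hn.trans (rotHpCoeff_mono n zero_le_one hy)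

/-! #### The lift `γ ↦ a⁺, q₁, γ − (1,0,0)` for `y < 1` -/

/-- `q₁ = (−1, 0, 1)`, the neighbour of `a⁺` at height `ξ = −1`. [cite: Beaton2014RotatedHoneycomb, §2 (Fig. 1(b): the rotated frame)] -/
def rotQ1 : HV := ((-1 : ℤ), (0 : ℤ), true)

/-- `a⁺ ∼ q₁`. [cite: Beaton2014RotatedHoneycomb, §2 (Fig. 1(b))] -/
theorem adj_hvOrigin_rotQ1 : hvGraph.Adj hvOrigin rotQ1 := by
  unfold rotQ1 hvOrigin; decide

/-- `q₁ ∼ a⁺ − (1,0,0)`. [cite: Beaton2014RotatedHoneycomb, §2 (Fig. 1(b))] -/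
theorem adj_rotQ1_shift_hvOrigin : hvGraph.Adj rotQ1 (shift (-1) 0 hvOrigin) := by
  rw [shift_apply]; unfold rotQ1 hvOrigin; decide

/-- `ξ(q₁) = −1`. [cite: Beaton2014RotatedHoneycomb, §2.2 (the height ξ)] -/
theorem xi_rotQ1 : xi rotQ1 = -1 := by
  unfold rotQ1; decide

/-- **The lift** `γ = [a⁺, γ₁, …] ↦ [a⁺, q₁, a⁺ − (1,0,0), γ₁ − (1,0,0), …]`: two more vertices, one surface vertex.
[cite: Beaton2014RotatedHoneycomb, Proposition 7 (arXiv v3 p. 11: "For 0 < y ≤ 1, μ(y) = μ(1) = μ")] -/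
def rotLift (l : List HV) : List HV := hvOrigin :: rotQ1 :: l.map (shift (-1) 0)

/-- The lift is injective. [cite: Beaton2014RotatedHoneycomb, Proposition 7 (arXiv v3 p. 11)] -/
theorem rotLift_injective : Function.Injective rotLift := by
  intro l l' h
  simp only [rotLift, List.cons.injEq, true_and] at h
  exact (List.map_injective_iff.2 (shift (-1) 0).injective) h

/-- The lift maps `n`-vertex half-plane walks to `(n+2)`-vertex half-plane walks. [cite: Beaton2014RotatedHoneycomb, Proposition 7 (arXiv v3 p. 11)] -/
theorem rotLift_mem {n : ℕ} {l : List HV} (hl : l ∈ rotHpWalks n) : rotLift l ∈ rotHpWalks (n + 2) := by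
  obtain ⟨hc, hh, hnd, hlen, hV⟩ := mem_rotHpWalks_iff.1 hl
  obtain ⟨M, rfl⟩ : ∃ M, l = hvOrigin :: M := by
    cases l with
    | nil => simp at hh
    | cons a M => simp at hh; exact ⟨M, by rw [hh]⟩
  have hximap : ∀ v ∈ (hvOrigin :: M).map (shift (-1) 0), xi v ≤ -2 := by
    intro v hv
    obtain ⟨w, hw, rfl⟩ := List.mem_map.1 hv
    have := hV w hw
    rw [xi_shift]
    omega
  rw [mem_rotHpWalks_iff, rotLift]
  refine ⟨?_, rfl, ?_, ?_, ?_⟩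
  · rw [List.map_cons, List.isChain_cons_cons, List.isChain_cons_cons, ← List.map_cons, List.isChain_map]
    exact ⟨adj_hvOrigin_rotQ1, adj_rotQ1_shift_hvOrigin, hc.imp fun a b h => ((shift (-1) 0).map_adj_iff).2 h⟩
  · rw [List.nodup_cons, List.nodup_cons, List.mem_cons]
    refine ⟨?_, fun h => ?_, hnd.map (shift (-1) 0).injective⟩
    · rintro (h | h)
      · revert h; unfold rotQ1 hvOrigin; decide
      · have := hximap _ h; rw [xi_hvOrigin] at this; omega
    · have := hximap _ h; rw [xi_rotQ1] at this; omega
  · simp only [List.length_cons, List.length_map] at hlen ⊢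
    omega
  · intro v hv
    rcases List.mem_cons.1 hv with rfl | hv
    · rw [xi_hvOrigin, neg_zero]
    · rcases List.mem_cons.1 hv with rfl | hv
      · rw [xi_rotQ1]; norm_num
      · have := hximap v hv; omega

/-- The lift has exactly one surface vertex (`a⁺`). [cite: Beaton2014RotatedHoneycomb, Proposition 7 (arXiv v3 p. 11)] -/
theorem surfCount_rotLift {n : ℕ} {l : List HV} (hl : l ∈ rotHpWalks n) : surfCount (rotLift l) = 1 := by
  obtain ⟨-, -, -, -, hV⟩ := mem_rotHpWalks_iff.1 hl
  have h0 : ((l.map (shift (-1) 0)).filter fun v => xi v = 0) = [] := by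
    rw [List.filter_eq_nil_iff]
    intro v hv
    obtain ⟨w, hw, rfl⟩ := List.mem_map.1 hv
    have := hV w hw
    simp only [decide_eq_true_eq, xi_shift]
    omega
  rw [surfCount, rotLift, List.filter_cons_of_pos (by simp [xi_hvOrigin]), List.filter_cons_of_neg (by simp [xi_rotQ1]), h0]
  rfl

/-- **`y · C⁺_n(1) ≤ C⁺_{n+2}(y)`** (`y ≥ 0`), by the lift. [cite: Beaton2014RotatedHoneycomb, Proposition 7 (arXiv v3 p. 11: "For 0 < y ≤ 1, μ(y) = μ(1) = μ")] -/
theorem mul_rotHpCoeff_one_le {y : ℝ} (hy : 0 ≤ y) (n : ℕ) : y * rotHpCoeff n 1 ≤ rotHpCoeff (n + 2) y := by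
  have h1 : y * rotHpCoeff n 1 = ∑ l ∈ rotHpWalks n, y ^ surfCount (rotLift l) := by
    rw [rotHpCoeff, mul_sum]
    refine sum_congr rfl fun l hl => ?_
    rw [surfCount_rotLift hl, one_pow, mul_one, pow_one]
  calc y * rotHpCoeff n 1 = ∑ l ∈ rotHpWalks n, y ^ surfCount (rotLift l) := h1
    _ = ∑ g ∈ (rotHpWalks n).image rotLift, y ^ surfCount g := by rw [sum_image rotLift_injective.injOn]
    _ ≤ rotHpCoeff (n + 2) y :=
        sum_le_sum_of_subset_of_nonneg (fun g hg => by
          obtain ⟨l, hl, rfl⟩ := mem_image.1 hg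
          exact rotLift_mem hl) fun _ _ _ => pow_nonneg hy _

/-- **`limsup_n C⁺_n(y)^{1/n} ≥ μ` for EVERY `y > 0`** (`y ≥ 1`: bridges; `y < 1`: the lift).
[cite: Beaton2014RotatedHoneycomb, Proposition 7 (arXiv v3 p. 11: "for any y > 0, μ(y) ≥ max{μ, √y}")] -/
theorem rotGrowthGe_of_pos {y : ℝ} (hy : 0 < y) : RotGrowthGe y := by
  intro r hr0 hr
  rcases hr0.eq_or_lt with rfl | hr0'
  · refine Filter.Eventually.frequently (Filter.eventually_atTop.2 ⟨1, fun n hn => ?_⟩)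
    rw [zero_pow (by omega)]
    exact rotHpCoeff_nonneg n hy.le
  obtain ⟨r', hrr', hr'μ⟩ := exists_between hr
  have h1 := rotGrowthGe_of_one_le le_rfl r' (hr0.trans hrr'.le) hr'μ
  have hev : ∀ᶠ n : ℕ in atTop, r ^ (n + 2) ≤ y * r' ^ n := by
    have hq : 1 < r' / r := (one_lt_div hr0').2 hrr'
    filter_upwards [(tendsto_pow_atTop_atTop_of_one_lt hq).eventually_ge_atTop (r ^ 2 / y)] with n hn
    rw [div_pow, div_le_div_iff₀ hy (pow_pos hr0' n)] at hn
    calc r ^ (n + 2) = r ^ 2 * r ^ n := by ring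
      _ ≤ r' ^ n * y := hn
      _ = y * r' ^ n := mul_comm _ _
  have h2 : ∃ᶠ n : ℕ in atTop, r ^ (n + 2) ≤ rotHpCoeff (n + 2) y :=
    (h1.and_eventually hev).mono fun n hn =>
      hn.2.trans ((mul_le_mul_of_nonneg_left hn.1 hy.le).trans (mul_rotHpCoeff_one_le hy.le n))
  rw [Filter.frequently_atTop] at h2 ⊢
  intro N
  obtain ⟨n, hn, h⟩ := h2 N
  exact ⟨n + 2, by omega, h⟩

/-- **`0 < y ≤ y†` ⇒ `limsup C⁺_n(y)^{1/n} = μ`** (both halves, endpoint included).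
[cite: Beaton2014RotatedHoneycomb, Proposition 7 (arXiv v3 p. 11: "μ(y) = μ if y ≤ y_c"), Theorem 1 (p. 2)] -/
theorem rotGrowth_eq_holds_of_le {y : ℝ} (hy0 : 0 < y) (hy : y ≤ rotYdagger) : RotGrowthLe y ∧ RotGrowthGe y :=
  ⟨(rotGrowthLe_iff_le hy0).2 hy, rotGrowthGe_of_pos hy0⟩

end Literature.Probability.RandomPlanarGeometry.SAW.HV

end
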